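import Summits.QuantumFields.YangMills.Theses.ParabolicTrajectory
import Literature.MathematicalPhysics.QuantumFieldTheory.BalabanBanachStep

/-!
# Triage r1-1 (gen 2) — machine checks for the crux-idea cards of `LatticeGapOnTrajectory`
(crux item stmt-QuantumFields-10523, conjunct (B) of route `ParabolicTrajectory`, rev 4)

Triager 1 of 3 (refuter-cruxtri-stmt-QuantumFields-10523-r1-1-g2-0). The card decls live in the crux
workfiles `SketchIdeator1.lean` / `SketchIdeator2.lean`, which are not importable modules on the farm
("unbuilt"), so the statements attacked here are COPIED VERBATIM into namespace `Triage1` and the copies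
are proved / refuted. Sections:

* §A `dissipative-bridge`: `TailTrapping` (verbatim) is a theorem — `tailTrapping_holds`.
* §B `af-repeller-ir-rigidity`: the card's corollary `NoReturnToFreePoint` (verbatim) is provable, AND its
  hypothesis is unsatisfiable (`no_orbit_stays`, after Triage3) — the card's owned "chart half" is vacuous.
* §C parity: `expect_wilson` pins odd tori only; for even `M` the torus index `(M^j(2T+1)-1)/2` used in
  `GapScalingFromChartPoint` does not name the torus `M^j(2T+1)`.
* §D `rt-arc-collapse` / `trajectory-gap-scaling` / `one-orbit-suffices`: the step-count inequality behind
  every collapse lemma — under the basin drift `g_{j+1} ≤ g_j + c g_j³` one has `g_j⁻² ≥ g_0⁻² − 2cj`, so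
  reaching coupling `γ` from `g` costs at least `(g⁻² − γ⁻²)/(2c)` steps (→ ∞ as `g → 0⁺`).
* §E `rt-arc-collapse`: the card's first lemma `WilsonOrbitsCollapse` (verbatim) is a THEOREM —
  `wilsonOrbitsCollapse_holds` (basin invariance → drift bound → zero propagation → positivity → step
  count `k ≥ j₀ + N + 1` for `g ≤ g₁ := min (min g₀ 1) Λ⁻¹` → absorption → attraction for `k − j₀ ≥ N` steps).
-/

open Filter Topology
open Literature.MathematicalPhysics.QuantumFieldTheory

noncomputable section

namespace Summit.QuantumFields.YangMills.Cruxes.LatticeGapOnTrajectory.Triage1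

/-! ## §A  dissipative-bridge: `TailTrapping` holds -/

/-- VERBATIM copy of `Sketch.TailTrapping` (SketchIdeator2.lean). -/
def TailTrapping : Prop :=
  ∀ (E : Type) [NormedAddCommGroup E] [NormedSpace ℝ E] [CompleteSpace E]
    (P : E →L[ℝ] E) (F : E → E) (N : ℕ → Set E) (ρ θ η : ℝ) (J : ℕ),
    (∀ x, P (P x) = P x) → 0 ≤ ρ → 0 ≤ θ → θ < 1 → 0 ≤ η → η ≤ (1 - θ) * ρ →
    (∀ i, ∀ x ∈ N i, P x = x) →
    (∀ i < J, ∀ x ∈ N i, ∀ w : E, P w = 0 → ‖w‖ ≤ ρ →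
        ‖F (x + w) - P (F (x + w))‖ ≤ θ * ‖w‖ + η) →
    (∀ i < J, ∀ x ∈ N i, ∀ w : E, P w = 0 → ‖w‖ ≤ ρ → P (F (x + w)) ∈ N (i + 1)) →
    ∀ z : E, P z ∈ N 0 → ‖z - P z‖ ≤ ρ →
      ∀ i ≤ J, P (F^[i] z) ∈ N i ∧ ‖F^[i] z - P (F^[i] z)‖ ≤ ρ

/-- `TailTrapping` is a theorem (induction on the step; the tail of `F^[i] z` is `F^[i] z − P (F^[i] z)`,
which `P` kills by idempotence). First lemma of card `dissipative-bridge`: CLOSES. -/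
theorem tailTrapping_holds : TailTrapping := by
  intro E _ _ _ P F N ρ θ η J hPP hρ hθ hθ1 hη hηρ hN htail hcover z hz0 hzρ
  -- joint induction on `i`
  have key : ∀ i, i ≤ J → P (F^[i] z) ∈ N i ∧ ‖F^[i] z - P (F^[i] z)‖ ≤ ρ := by
    intro i
    induction i with
    | zero => intro _; exact ⟨by simpa using hz0, by simpa using hzρ⟩
    | succ i ih =>
      intro hi
      have hiJ : i < J := Nat.lt_of_succ_le hi
      obtain ⟨hx, hw⟩ := ih hiJ.le
      set x := P (F^[i] z) with hx_def
      set w := F^[i] z - P (F^[i] z) with hw_def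
      have hPw : P w = 0 := by
        rw [hw_def, map_sub, hPP, sub_self]
      have hsplit : F^[i + 1] z = F (x + w) := by
        rw [Function.iterate_succ_apply', hx_def, hw_def, add_sub_cancel]
      refine ⟨?_, ?_⟩
      · rw [hsplit]; exact hcover i hiJ x hx w hPw hw
      · rw [hsplit]
        calc ‖F (x + w) - P (F (x + w))‖ ≤ θ * ‖w‖ + η := htail i hiJ x hx w hPw hw
          _ ≤ θ * ρ + (1 - θ) * ρ := by gcongr
          _ = ρ := by ring
  exact fun i hi => key i hi

/-! ## §B  af-repeller-ir-rigidity: the owned corollary is provable and vacuous -/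

section Repeller

variable {G : Type} [Group G] [TopologicalSpace G] [IsTopologicalGroup G] [CompactSpace G]
  [MeasurableSpace G] [BorelSpace G] {r : LatticeRep G} {M : ℕ}

/-- Quantitative repeller (after `Sketch.chartRepeller_holds` / `Triage3.step_gain`): in the
`ρ`-neighbourhood, `ρ = min δ (b/(4C))`, one step gains at least `(b/2) g³` in the coupling. -/
theorem step_gain (S : BalabanBanachStep G r M) {g : ℝ} {y : S.E} (hg : 0 ≤ g)
    (hgρ : g ≤ min S.δ (S.b / (4 * S.C))) (hyρ : ‖y‖ ≤ min S.δ (S.b / (4 * S.C))) :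
    g + S.b / 2 * g ^ 3 ≤ S.φ g y := by
  have hb := S.b_pos
  have hC := S.C_pos
  have hgδ : g ≤ S.δ := hgρ.trans (min_le_left _ _)
  have hyδ : ‖y‖ ≤ S.δ := hyρ.trans (min_le_left _ _)
  have hgb : g ≤ S.b / (4 * S.C) := hgρ.trans (min_le_right _ _)
  have hyb : ‖y‖ ≤ S.b / (4 * S.C) := hyρ.trans (min_le_right _ _)
  have habs : |g| = g := abs_of_nonneg hg
  have hrem := (S.remainder g y (by rw [habs]; exact hgδ) hyδ).1
  rw [habs] at hrem
  have hlow : g + S.b * g ^ 3 - S.C * (g ^ 4 + g ^ 3 * ‖y‖) ≤ S.φ g y := by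
    have := (abs_le.1 hrem).1; linarith
  have hCg : S.C * g ≤ S.b / 4 := by
    calc S.C * g ≤ S.C * (S.b / (4 * S.C)) := mul_le_mul_of_nonneg_left hgb hC.le
      _ = S.b / 4 := by field_simp
  have hCy : S.C * ‖y‖ ≤ S.b / 4 := by
    calc S.C * ‖y‖ ≤ S.C * (S.b / (4 * S.C)) := mul_le_mul_of_nonneg_left hyb hC.le
      _ = S.b / 4 := by field_simp
  have hg3 : 0 ≤ g ^ 3 := by positivity
  have hkey : S.C * (g ^ 4 + g ^ 3 * ‖y‖) ≤ (S.b / 2) * g ^ 3 := by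
    have h1 : S.C * (g ^ 4 + g ^ 3 * ‖y‖) = (S.C * g + S.C * ‖y‖) * g ^ 3 := by ring
    rw [h1]
    exact mul_le_mul_of_nonneg_right (by linarith) hg3
  linarith

/-- Along an orbit staying in the `ρ`-neighbourhood with positive coupling, the coupling never drops
below its initial value and grows at least linearly: `g₀ + i (b/2) g₀³ ≤ g_i`. -/
theorem coupling_ge_linear (S : BalabanBanachStep G r M) (p : ℝ × S.E) (hp : 0 < p.1) (i : ℕ)
    (horb : ∀ j ≤ i, (S.F^[j] p).1 ∈ Set.Ioc 0 (min S.δ (S.b / (4 * S.C))) ∧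
      ‖(S.F^[j] p).2‖ ≤ min S.δ (S.b / (4 * S.C))) :
    p.1 + i * (S.b / 2 * p.1 ^ 3) ≤ (S.F^[i] p).1 ∧ p.1 ≤ (S.F^[i] p).1 := by
  induction i with
  | zero => simp
  | succ i ih =>
    have ih' := ih (fun j hj => horb j (hj.trans (Nat.le_succ i)))
    have hi := horb i (Nat.le_succ i)
    have hgain : (S.F^[i] p).1 + S.b / 2 * (S.F^[i] p).1 ^ 3 ≤ (S.F^[i + 1] p).1 := by
      rw [Function.iterate_succ_apply']
      exact step_gain S hi.1.1.le hi.1.2 hi.2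
    have hcube : p.1 ^ 3 ≤ (S.F^[i] p).1 ^ 3 := by
      have h0 : 0 ≤ p.1 := hp.le
      have h1 : p.1 ≤ (S.F^[i] p).1 := ih'.2
      gcongr
    have hb2 : 0 ≤ S.b / 2 := by have := S.b_pos; positivity
    have := mul_le_mul_of_nonneg_left hcube hb2
    constructor
    · push_cast
      nlinarith [ih'.1]
    · have h3 : 0 ≤ S.b / 2 * (S.F^[i] p).1 ^ 3 := by
        have := hi.1.1.le; positivity
      linarith [ih'.2]

/-- **Vacuity** (after `Triage3.no_orbit_stays`, re-checked here): for every instance `S`, NO orbit with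
positive initial coupling stays in the `ρ`-neighbourhood of the free point for all times,
`ρ = min δ (b/(4C))` being the card's own radius. -/
theorem no_orbit_stays (S : BalabanBanachStep G r M) (p : ℝ × S.E) (hp : 0 < p.1) :
    ¬ (∀ i : ℕ, (S.F^[i] p).1 ∈ Set.Ioc 0 (min S.δ (S.b / (4 * S.C))) ∧
        ‖(S.F^[i] p).2‖ ≤ min S.δ (S.b / (4 * S.C))) := by
  intro horb
  have hb := S.b_pos
  have hgain : 0 < S.b / 2 * p.1 ^ 3 := by positivity
  obtain ⟨i, hi⟩ := exists_nat_gt ((min S.δ (S.b / (4 * S.C)) - p.1) / (S.b / 2 * p.1 ^ 3))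
  have h1 := (coupling_ge_linear S p hp i (fun j _ => horb j)).1
  have h2 : (S.F^[i] p).1 ≤ min S.δ (S.b / (4 * S.C)) := (horb i).1.2
  have h3 : min S.δ (S.b / (4 * S.C)) - p.1 < i * (S.b / 2 * p.1 ^ 3) := by
    rwa [div_lt_iff₀ hgain] at hi
  linarith

end Repeller

/-- VERBATIM copy of `Sketch.NoReturnToFreePoint` (SketchIdeator1.lean), the card's "corollary, provable
now". -/
def NoReturnToFreePoint : Prop :=
  ∀ (G : Type) [Group G] [TopologicalSpace G] [IsTopologicalGroup G] [CompactSpace G]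
    [MeasurableSpace G] [BorelSpace G] (r : LatticeRep G) (M : ℕ) (S : BalabanBanachStep G r M),
    ∃ ρ : ℝ, 0 < ρ ∧
      ∀ p : ℝ × S.E, 0 < p.1 →
        (∀ i : ℕ, (S.F^[i] p).1 ∈ Set.Ioc 0 ρ ∧ ‖(S.F^[i] p).2‖ ≤ ρ) →
        ¬ Tendsto (fun i => S.F^[i] p) atTop (𝓝 ((0 : ℝ), (0 : S.E)))

/-- `NoReturnToFreePoint` holds — VACUOUSLY: with the card's radius its orbit hypothesis is never met
(`no_orbit_stays`), so the conclusion is never invoked. The "chart half this route already owns"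
therefore excludes no infrared limit whatsoever. -/
theorem noReturnToFreePoint_vacuous : NoReturnToFreePoint := by
  intro G _ _ _ _ _ _ r M S
  refine ⟨min S.δ (S.b / (4 * S.C)), lt_min S.δ_pos (by have := S.b_pos; have := S.C_pos; positivity),
    ?_⟩
  intro p hp horb _
  exact no_orbit_stays S p hp horb

/-! ## §C  parity of the block factor -/

/-- For `M = 2`, `j = 1`, `T = 0`: the torus index `(M^j(2T+1) − 1)/2 = 0` names the torus of side
`2·0+1 = 1 ≠ 2 = M^j(2T+1)` — `expect_wilson` (odd tori `2L+1`) does not meet `expect_iterate`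
(torus `M^j(2T+1)`) for even `M`. -/
example : 2 * ((2 ^ 1 * (2 * 0 + 1) - 1) / 2) + 1 ≠ 2 ^ 1 * (2 * 0 + 1) := by decide

/-- Same for every even `M ≥ 2` and every `j ≥ 1`, `T`: the reconstructed side is odd, the target even. -/
theorem even_block_factor_mismatch (M j T : ℕ) (hM : Even M) (hj : 1 ≤ j) :
    2 * ((M ^ j * (2 * T + 1) - 1) / 2) + 1 ≠ M ^ j * (2 * T + 1) := by
  intro h
  have heven : Even (M ^ j * (2 * T + 1)) := by
    have : Even (M ^ j) := (Nat.even_pow' (by omega)).2 hM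
    exact this.mul_right _
  have hodd : Odd (2 * ((M ^ j * (2 * T + 1) - 1) / 2) + 1) := odd_two_mul_add_one _
  rw [h] at hodd
  exact (Nat.not_even_iff_odd.2 hodd) heven

/-- For odd `M` the bookkeeping is exact: `2·((M^j(2T+1) − 1)/2) + 1 = M^j(2T+1)`. -/
theorem odd_block_factor_exact (M j T : ℕ) (hM : Odd M) :
    2 * ((M ^ j * (2 * T + 1) - 1) / 2) + 1 = M ^ j * (2 * T + 1) := by
  have hodd : Odd (M ^ j * (2 * T + 1)) := (hM.pow).mul (odd_two_mul_add_one T)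
  obtain ⟨m, hm⟩ := hodd
  omega

/-! ## §D  the step count behind every collapse lemma -/

/-- One step of basin drift costs at most `2c` in `g⁻²`: from `0 < g`, `0 < g'`, `g' ≤ g + c g³`
(`c ≥ 0`) we get `g⁻² − 2c ≤ g'⁻²`. -/
theorem inv_sq_step {g g' c : ℝ} (hg : 0 < g) (hg' : 0 < g') (hc : 0 ≤ c)
    (hstep : g' ≤ g + c * g ^ 3) : 1 / g ^ 2 - 2 * c ≤ 1 / g' ^ 2 := by
  have hx : 0 ≤ c * g ^ 2 := by positivity
  have hpos : 0 < g * (1 + c * g ^ 2) := by positivity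
  have h1 : 1 / (g * (1 + c * g ^ 2)) ^ 2 ≤ 1 / g' ^ 2 := by
    apply one_div_le_one_div_of_le (by positivity)
    have : g' ≤ g * (1 + c * g ^ 2) := by nlinarith
    exact pow_le_pow_left₀ hg'.le this 2
  refine le_trans ?_ h1
  rw [div_sub' (by positivity), div_le_div_iff₀ (by positivity) (by positivity)]
  nlinarith [sq_nonneg (c * g ^ 2), mul_nonneg hx (sq_nonneg (c * g ^ 2)), sq_nonneg g,
    mul_nonneg hx (sq_nonneg g)]

/-- Iterated: along any positive sequence with `u (j+1) ≤ u j + c (u j)³`, `u 0⁻² − 2cj ≤ (u j)⁻²`. -/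
theorem inv_sq_iterate (u : ℕ → ℝ) (c : ℝ) (hc : 0 ≤ c) (hpos : ∀ j, 0 < u j)
    (hstep : ∀ j, u (j + 1) ≤ u j + c * u j ^ 3) (j : ℕ) :
    1 / u 0 ^ 2 - 2 * c * j ≤ 1 / u j ^ 2 := by
  induction j with
  | zero => simp
  | succ j ih =>
    have := inv_sq_step (hpos j) (hpos (j + 1)) hc (hstep j)
    push_cast
    linarith

/-- **Step count.** If such a sequence started at `u 0 = g` has reached `γ ≤ u k`, then
`(g⁻² − γ⁻²)/(2c) ≤ k` (for `c > 0`). As `g → 0⁺` the left side → ∞: every collapse lemma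
(`WilsonOrbitsCollapse`, the visiting clause of `OnePointOpenClustering`, `HeteroclinicEntrance`'s
landing) gets its "arbitrarily many attracting steps before landing" from here. -/
theorem steps_to_reach (u : ℕ → ℝ) (c γ : ℝ) (hc : 0 < c) (hγ : 0 < γ) (hpos : ∀ j, 0 < u j)
    (hstep : ∀ j, u (j + 1) ≤ u j + c * u j ^ 3) (k : ℕ) (hk : γ ≤ u k) :
    (1 / u 0 ^ 2 - 1 / γ ^ 2) / (2 * c) ≤ k := by
  have h1 := inv_sq_iterate u c hc.le hpos hstep k
  have h2 : 1 / u k ^ 2 ≤ 1 / γ ^ 2 := by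
    apply one_div_le_one_div_of_le (by positivity)
    exact pow_le_pow_left₀ hγ.le hk 2
  rw [div_le_iff₀ (by positivity)]
  linarith

/-! ## §E  rt-arc-collapse: the first lemma `WilsonOrbitsCollapse` PROVED -/

/-- VERBATIM copy of `Sketch.WilsonOrbitsCollapse` (SketchIdeator2.lean). -/
def WilsonOrbitsCollapse : Prop :=
  ∀ (G : Type) [Group G] [TopologicalSpace G] [IsTopologicalGroup G] [CompactSpace G]
    [MeasurableSpace G] [BorelSpace G] (r : LatticeRep G) (M : ℕ) (S : BalabanBanachStep G r M)
    (δ' K θ₁ : ℝ) (h : ℝ → S.E),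
    0 < δ' → δ' ≤ S.δ → 0 ≤ K → 0 ≤ θ₁ → θ₁ < 1 →
    (∀ g ∈ Set.Icc 0 δ', ‖h g‖ ≤ δ') →
    (∀ (p : ℝ × S.E) (k : ℕ),
        (∀ j ≤ k, (S.F^[j] p).1 ∈ Set.Icc 0 δ' ∧ ‖(S.F^[j] p).2‖ ≤ δ') →
          ‖(S.F^[k] p).2 - h (S.F^[k] p).1‖ ≤ K * θ₁ ^ k * ‖p.2 - h p.1‖) →
    (∀ p : ℝ × S.E, p.1 ∈ Set.Icc 0 δ' → ‖p.2‖ ≤ S.R → ‖(S.F p).2‖ ≤ S.R) →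
    (∃ j₀ : ℕ, ∀ (p : ℝ × S.E) (k : ℕ), ‖p.2‖ ≤ S.R →
        (∀ j ≤ k, (S.F^[j] p).1 ∈ Set.Icc 0 δ') → j₀ ≤ k → ‖(S.F^[k] p).2‖ ≤ δ') →
    ∀ γ ∈ Set.Ioc 0 δ', ∀ ε : ℝ, 0 < ε →
      ∃ g₁ : ℝ, 0 < g₁ ∧ g₁ ≤ S.g₀ ∧
        ∀ g ∈ Set.Ioc 0 g₁, ∀ k : ℕ,
          (∀ j ≤ k, (S.F^[j] (g, S.yW g)).1 ∈ Set.Icc 0 δ') →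
          γ ≤ (S.F^[k] (g, S.yW g)).1 →
            ‖(S.F^[k] (g, S.yW g)).2 - h (S.F^[k] (g, S.yW g)).1‖ ≤ ε

/-- **`WilsonOrbitsCollapse` holds.** Proof: (1) the fibre stays in the `R`-ball (BASIN), so the basin
remainder bound caps the coupling drift, `g_{j+1} ≤ g_j + c' g_j³`, `c' = b + C(δ' + R)`; a zero
coupling propagates, so `γ ≤ g_k`, `γ > 0` forces all `g_j > 0`; hence `g_j⁻² ≥ g⁻² − 2c'j` and
`k ≥ (g⁻² − γ⁻²)/(2c')`, which exceeds `j₀ + N` once `g ≤ g₁`; (2) after `j₀` steps the fibre is in the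
`δ'`-ball (ABSORB) and stays there, so ATTRACTION for the remaining `k − j₀ ≥ N` steps gives
`‖y_k − h g_k‖ ≤ K θ₁^{k−j₀} · 2δ' ≤ ε`. -/
theorem wilsonOrbitsCollapse_holds : WilsonOrbitsCollapse := by
  intro G _ _ _ _ _ _ r M S δ' K θ₁ h hδ' hδ'δ hK hθ₁ hθ₁1 hh hattr hbasin habs γ hγ ε hε
  obtain ⟨j₀, hj₀⟩ := habs
  -- the attraction horizon `N`: `K θ₁^N (2δ') ≤ ε`
  obtain ⟨N, hN⟩ : ∃ N : ℕ, K * θ₁ ^ N * (2 * δ') ≤ ε := by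
    obtain ⟨N, hN⟩ := exists_pow_lt_of_lt_one (show 0 < ε / (2 * K * δ' + 1) by positivity) hθ₁1
    refine ⟨N, ?_⟩
    have h1 : K * θ₁ ^ N * (2 * δ') ≤ K * (ε / (2 * K * δ' + 1)) * (2 * δ') := by
      gcongr
    refine h1.trans ?_
    rw [show K * (ε / (2 * K * δ' + 1)) * (2 * δ') = ε * (2 * K * δ' / (2 * K * δ' + 1)) by ring]
    have : 2 * K * δ' / (2 * K * δ' + 1) ≤ 1 := by
      rw [div_le_one (by positivity)]; linarith
    nlinarith
  -- the drift constant and the threshold `Λ` on `g⁻²`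
  set c' : ℝ := S.b + S.C * (δ' + S.R) with hc'_def
  have hc' : 0 < c' := by
    have := S.b_pos; have := S.C_pos; have := S.R_pos; positivity
  set Λ : ℝ := 1 / γ ^ 2 + 2 * c' * ((j₀ : ℝ) + N + 1) with hΛ_def
  have hΛ : 0 < Λ := by have := hγ.1; positivity
  refine ⟨min (min S.g₀ 1) (1 / Λ), lt_min (lt_min S.g₀_pos one_pos) (by positivity),
    (min_le_left _ _).trans (min_le_left _ _), ?_⟩
  intro g hg k hcoup hγk
  have hg0 : 0 < g := hg.1
  have hg₀ : g ≤ S.g₀ := hg.2.trans ((min_le_left _ _).trans (min_le_left _ _))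
  have hg1 : g ≤ 1 := hg.2.trans ((min_le_left _ _).trans (min_le_right _ _))
  have hgΛ : g ≤ 1 / Λ := hg.2.trans (min_le_right _ _)
  set p₀ : ℝ × S.E := (g, S.yW g) with hp₀_def
  -- (1a) the fibre stays in the basin up to step `k`
  have hR : ∀ j ≤ k, ‖(S.F^[j] p₀).2‖ ≤ S.R := by
    intro j
    induction j with
    | zero => intro _; simpa [hp₀_def] using S.norm_yW_le g ⟨hg0.le, hg₀⟩
    | succ j ih =>
      intro hj
      have hjk : j ≤ k := (Nat.le_succ j).trans hj
      rw [Function.iterate_succ_apply']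
      exact hbasin _ (hcoup j hjk) (ih hjk)
  -- (1b) drift bound and zero propagation
  have hdrift : ∀ j < k, (S.F^[j + 1] p₀).1 ≤ (S.F^[j] p₀).1 + c' * (S.F^[j] p₀).1 ^ 3 := by
    intro j hj
    have hgj := hcoup j hj.le
    have hyj := hR j hj.le
    set gj := (S.F^[j] p₀).1 with hgj_def
    set yj := (S.F^[j] p₀).2
    have habs : |gj| = gj := abs_of_nonneg hgj.1
    have hrb := S.remainder_basin gj yj (by rw [habs]; exact hgj.2.trans hδ'δ) hyj
    rw [habs] at hrb
    have hup : S.φ gj yj ≤ gj + S.b * gj ^ 3 + S.C * (gj ^ 4 + gj ^ 3 * ‖yj‖) := by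
      have := (abs_le.1 hrb).2; linarith
    have hg4 : gj ^ 4 ≤ δ' * gj ^ 3 := by
      have : gj ^ 4 = gj * gj ^ 3 := by ring
      rw [this]; exact mul_le_mul_of_nonneg_right hgj.2 (by have := hgj.1; positivity)
    have hg3R : gj ^ 3 * ‖yj‖ ≤ gj ^ 3 * S.R :=
      mul_le_mul_of_nonneg_left hyj (by have := hgj.1; positivity)
    have hF : (S.F^[j + 1] p₀).1 = S.φ gj yj := by
      rw [Function.iterate_succ_apply']; rfl
    rw [hF]
    have hC := S.C_pos.le
    calc S.φ gj yj ≤ gj + S.b * gj ^ 3 + S.C * (gj ^ 4 + gj ^ 3 * ‖yj‖) := hup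
      _ ≤ gj + S.b * gj ^ 3 + S.C * (δ' * gj ^ 3 + gj ^ 3 * S.R) := by gcongr
      _ = gj + c' * gj ^ 3 := by rw [hc'_def]; ring
  have hzero : ∀ j < k, (S.F^[j] p₀).1 = 0 → (S.F^[j + 1] p₀).1 = 0 := by
    intro j hj h0
    have hyj := hR j hj.le
    have hrb := S.remainder_basin (S.F^[j] p₀).1 (S.F^[j] p₀).2
      (by rw [h0]; simp [S.δ_pos.le]) hyj
    rw [h0] at hrb
    have hF : (S.F^[j + 1] p₀).1 = S.φ (S.F^[j] p₀).1 (S.F^[j] p₀).2 := by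
      rw [Function.iterate_succ_apply']; rfl
    rw [hF, h0]
    simpa using hrb
  -- (1c) all couplings up to `k` are positive
  have hpos : ∀ j ≤ k, 0 < (S.F^[j] p₀).1 := by
    intro j hj
    rcases (hcoup j hj).1.eq_or_lt with h0 | hlt
    · exfalso
      -- zero at `j` propagates to `k`
      have hprop : ∀ i, j ≤ i → i ≤ k → (S.F^[i] p₀).1 = 0 := by
        intro i hji hik
        induction i with
        | zero =>
          have : j = 0 := Nat.le_zero.mp hji
          subst this; exact h0.symm
        | succ i ih =>
          rcases Nat.lt_or_ge j (i + 1) with hlt' | hge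
          · exact hzero i (Nat.lt_of_succ_le hik) (ih (Nat.lt_succ_iff.mp hlt') ((Nat.le_succ i).trans hik))
          · have : j = i + 1 := le_antisymm hji hge
            subst this; exact h0.symm
      have := hprop k hj le_rfl
      linarith [hγ.1]
    · exact hlt
  -- (1d) inverse-square bookkeeping and the step count
  have hinv : ∀ j ≤ k, 1 / g ^ 2 - 2 * c' * j ≤ 1 / (S.F^[j] p₀).1 ^ 2 := by
    intro j
    induction j with
    | zero => intro _; simp [hp₀_def]
    | succ j ih =>
      intro hj
      have hjk : j < k := Nat.lt_of_succ_le hj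
      have := inv_sq_step (hpos j hjk.le) (hpos (j + 1) hj) hc'.le (hdrift j hjk)
      push_cast
      linarith [ih hjk.le]
  have hkbig : (j₀ : ℝ) + N + 1 ≤ k := by
    have h1 := hinv k le_rfl
    have h2 : 1 / (S.F^[k] p₀).1 ^ 2 ≤ 1 / γ ^ 2 := by
      apply one_div_le_one_div_of_le (by have := hγ.1; positivity)
      exact pow_le_pow_left₀ hγ.1.le hγk 2
    have h3 : Λ ≤ 1 / g ^ 2 := by
      have hg2 : g ^ 2 ≤ g := by nlinarith
      have : 1 / g ≤ 1 / g ^ 2 := one_div_le_one_div_of_le (by positivity) hg2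
      refine le_trans ?_ this
      rw [le_one_div hΛ hg0]
      exact hgΛ
    have h4 : Λ - 2 * c' * k ≤ 1 / γ ^ 2 := by linarith
    rw [hΛ_def] at h4
    nlinarith
  have hkN : j₀ + N ≤ k := by
    have : ((j₀ + N : ℕ) : ℝ) ≤ k := by push_cast; linarith
    exact_mod_cast this
  -- (2) absorption then attraction for the last `k − j₀` steps
  set q : ℝ × S.E := S.F^[j₀] p₀ with hq_def
  have hiter : ∀ i, S.F^[i] q = S.F^[i + j₀] p₀ := by
    intro i; rw [hq_def, ← Function.iterate_add_apply]
  have hj₀k : j₀ ≤ k := le_trans (Nat.le_add_right _ _) hkN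
  have hseg : ∀ i ≤ k - j₀, (S.F^[i] q).1 ∈ Set.Icc 0 δ' ∧ ‖(S.F^[i] q).2‖ ≤ δ' := by
    intro i hi
    have hik : i + j₀ ≤ k := by omega
    rw [hiter i]
    refine ⟨hcoup _ hik, ?_⟩
    refine hj₀ p₀ (i + j₀) ?_ (fun j hj => hcoup j (hj.trans hik)) (Nat.le_add_left _ _)
    simpa [hp₀_def] using S.norm_yW_le g ⟨hg0.le, hg₀⟩
  have hatt := hattr q (k - j₀) hseg
  have hkq : S.F^[k - j₀] q = S.F^[k] p₀ := by
    rw [hiter]; congr 1; omega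
  rw [hkq] at hatt
  have hq0 : ‖q.2 - h q.1‖ ≤ 2 * δ' := by
    have h1 : ‖q.2‖ ≤ δ' := by
      have := (hseg 0 (Nat.zero_le _)).2
      simpa using this
    have h2 : ‖h q.1‖ ≤ δ' := by
      have := (hseg 0 (Nat.zero_le _)).1
      exact hh _ (by simpa using this)
    calc ‖q.2 - h q.1‖ ≤ ‖q.2‖ + ‖h q.1‖ := norm_sub_le _ _
      _ ≤ δ' + δ' := add_le_add h1 h2
      _ = 2 * δ' := by ring
  have hθpow : θ₁ ^ (k - j₀) ≤ θ₁ ^ N :=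
    pow_le_pow_of_le_one hθ₁ hθ₁1.le (by omega)
  calc ‖(S.F^[k] p₀).2 - h (S.F^[k] p₀).1‖
      ≤ K * θ₁ ^ (k - j₀) * ‖q.2 - h q.1‖ := hatt
    _ ≤ K * θ₁ ^ N * (2 * δ') := by gcongr
    _ ≤ ε := hN

end Summit.QuantumFields.YangMills.Cruxes.LatticeGapOnTrajectory.Triage1

end
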